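import Summits.Ventures.HodgeKum4.Theorems.KummerFixedLocusL1HilbModelBasis
import HarnessLib

/-!
# Lane (V), line v2p5 — stub S-C: the model transport for an abelian surface

Cell `hodge-kum4`, crux stmt-Ventures-20141, registered stub `stub_model` of the v2p5 skeleton.  For an abelian surface
`A` and a class `α ∈ H²` with a dual Lefschetz operator `Λ_A`: from any basis `u` of `H¹` (`dim H¹ = 4`,
`Motives.abelianVarietyCohomologyExteriorH1_holds`) the expansion `α = Σ_{i<j} c_{ij} u_i u_j` has a non-zero coefficient
(`α ⌣ α ≠ 0`, `…ModelBasis.sq_ne_zero`), and after reordering `u` the symplectic Gram–Schmidt of `…ModelBasis` gives a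
basis `g` with `α = g₀g₁ + g₂g₃`; in the basis `b = bvec g` of `H*(A(ℂ); ℂ)` left cup products are the matrices
`mulMat I`, the degree operator is `diag(|I| − 2)`, `L_α` is `mulMat 3 + mulMat 12`, and the integer identities
`[L, lamMat] = h`, `[h, lamMat] = −2·lamMat` (`decide`) make `toLin b b lamMat` an `𝔰𝔩₂`-partner of `(L_α, h)`, equal
to `Λ_A` by uniqueness (`Algebra.Lie.dualPartner_unique`).  Nothing here asserts L1-Hilb(n) / L1 / HC_Kum4Type / HC.
-/

noncomputable section

open DirectSum
open Literature.AlgebraicTopology.SingularHomology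
open Literature.AlgebraicGeometry Literature.AlgebraicGeometry.Hyperkaehler Literature.AlgebraicGeometry.HilbertScheme
open Literature.AlgebraicGeometry.HodgeTheory (complexBetti)
open Literature.AlgebraicGeometry.Motives (AbelianVariety ComplexPoints SchemeOver IsSmoothProjective)

namespace Summit.Ventures.HodgeKum4.L1Hilb

namespace Model

/-! ### (3) The symplectic basis from any basis, and the transport of `Λ_A` -/

section Assembly

variable {A : AbelianVariety ℂ} (hA : A.dim = 2)

/-- From ANY basis `u` of `H¹`: a symplectic basis `g` with `α = g₀g₁ + g₂g₃` (six pivot cases reduced to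
`gramSchmidt` by reordering `u`). -/
theorem exists_symplectic (hA : A.dim = 2) (α : complexBetti A.X 2)
    (Λ : Module.End ℂ (totalCohomology ℂ (ComplexPoints A.X))) (hΛ : IsDualLefschetz 2 α Λ) :
    ∃ g : Module.Basis (Fin 4) ℂ (complexBetti A.X 1), ofDegree ℂ (ComplexPoints A.X) 2 α =
      totalCup ℂ _ (e g 0) (e g 1) + totalCup ℂ _ (e g 2) (e g 3) := by
  haveI : Module.Finite ℂ (complexBetti A.X 1) := Motives.abelianVarietyCohomologyExteriorH1_holds.finite_one A
  have hrank : Module.finrank ℂ (complexBetti A.X 1) = 4 := by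
    rw [Motives.abelianVarietyCohomologyExteriorH1_holds.finrank_one A, hA]
  set u := Module.finBasisOfFinrankEq ℂ (complexBetti A.X 1) hrank with hu
  obtain ⟨c, hc⟩ := exists_coeffs hA u α
  have hsq := sq_ne_zero α Λ hΛ
  set a := ofDegree ℂ (ComplexPoints A.X) 2 α with ha
  -- spanning of the reordered families
  have hspan : ∀ σ : Fin 4 → Fin 4, Function.Surjective σ → ⊤ ≤ Submodule.span ℂ (Set.range (u ∘ σ)) := by
    intro σ hσ
    rw [hσ.range_comp, u.span_eq]
  have hsurj : ∀ σ : Fin 4 → Fin 4, Function.Injective σ → Function.Surjective σ :=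
    fun σ hσ ↦ Finite.surjective_of_injective hσ
  -- anticommutation instances
  have hc10 := e_mul_comm u 1 0
  have hc20 := e_mul_comm u 2 0
  have hc30 := e_mul_comm u 3 0
  have hc21 := e_mul_comm u 2 1
  have hc31 := e_mul_comm u 3 1
  have hc32 := e_mul_comm u 3 2
  -- some coefficient is non-zero
  by_cases h3 : c 3 ≠ 0
  · exact gramSchmidt hA u (by rw [u.span_eq]) c a hc h3 hsq
  by_cases h5 : c 5 ≠ 0
  · refine gramSchmidt hA (u ∘ ![0, 2, 1, 3]) (hspan _ (hsurj _ (by decide)))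
      ![0, 0, 0, c 5, 0, c 3, -c 6, 0, 0, c 9, c 12, 0, c 10, 0, 0, 0] a ?_ (by simpa using h5) hsq
    simp only [e_def, Function.comp_apply, Matrix.cons_val] at hc ⊢
    rw [hc]
    simp only [← e_def] at hc21 ⊢
    rw [hc21]; module
  by_cases h6 : c 6 ≠ 0
  · refine gramSchmidt hA (u ∘ ![1, 2, 0, 3]) (hspan _ (hsurj _ (by decide)))
      ![0, 0, 0, c 6, 0, -c 3, -c 5, 0, 0, c 10, c 12, 0, c 9, 0, 0, 0] a ?_ (by simpa using h6) hsq
    simp only [e_def, Function.comp_apply, Matrix.cons_val] at hc ⊢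
    rw [hc]
    simp only [← e_def] at hc10 hc20 ⊢
    rw [hc10, hc20]; module
  by_cases h9 : c 9 ≠ 0
  · refine gramSchmidt hA (u ∘ ![0, 3, 1, 2]) (hspan _ (hsurj _ (by decide)))
      ![0, 0, 0, c 9, 0, c 3, -c 10, 0, 0, c 5, -c 12, 0, c 6, 0, 0, 0] a ?_ (by simpa using h9) hsq
    simp only [e_def, Function.comp_apply, Matrix.cons_val] at hc ⊢
    rw [hc]
    simp only [← e_def] at hc31 hc32 ⊢
    rw [hc31, hc32]; module
  by_cases h10 : c 10 ≠ 0
  · refine gramSchmidt hA (u ∘ ![1, 3, 0, 2]) (hspan _ (hsurj _ (by decide)))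
      ![0, 0, 0, c 10, 0, -c 3, -c 9, 0, 0, c 6, -c 12, 0, c 5, 0, 0, 0] a ?_ (by simpa using h10) hsq
    simp only [e_def, Function.comp_apply, Matrix.cons_val] at hc ⊢
    rw [hc]
    simp only [← e_def] at hc10 hc30 hc32 ⊢
    rw [hc10, hc30, hc32]; module
  by_cases h12 : c 12 ≠ 0
  · refine gramSchmidt hA (u ∘ ![2, 3, 0, 1]) (hspan _ (hsurj _ (by decide)))
      ![0, 0, 0, c 12, 0, -c 5, -c 9, 0, 0, -c 6, -c 10, 0, c 3, 0, 0, 0] a ?_ (by simpa using h12) hsq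
    simp only [e_def, Function.comp_apply, Matrix.cons_val] at hc ⊢
    rw [hc]
    simp only [← e_def] at hc20 hc30 hc21 hc31 ⊢
    rw [hc20, hc30, hc21, hc31]; module
  -- all six vanish: `a = 0`, contradicting `a ⌣ a ≠ 0`
  exfalso
  rw [not_ne_iff] at h3 h5 h6 h9 h10 h12
  apply hsq
  rw [hc, h3, h5, h6, h9, h10, h12]
  simp

/-- The degree operator in the basis `bvec g`: the diagonal matrix `deg4 I − 2`. -/
theorem degreeOperator_eq_Φ (g : Module.Basis (Fin 4) ℂ (complexBetti A.X 1)) :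
    degreeOperator ℂ (ComplexPoints A.X) 2 =
      Eval.Φ (basisB g hA) (Matrix.diagonal fun I : Fin 16 ↦ (deg4 I : ℤ) - 2) := by
  refine (basisB g hA).ext fun P ↦ ?_
  rw [Eval.Φ_basis, Finset.sum_eq_single P (fun Q _ hQ ↦ by rw [Matrix.diagonal_apply_ne _ hQ, Int.cast_zero, zero_smul])
    (by simp), Matrix.diagonal_apply_eq]
  obtain ⟨y, hy⟩ := (basisB_apply hA g P) ▸ bvec_mem_range g P
  rw [← hy, degreeOperator_lof]
  norm_cast

/-- The Lefschetz operator of `α = g₀g₁ + g₂g₃` in the basis `bvec g`: the matrix `mulMat 3 + mulMat 12`. -/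
theorem totalLefschetz_eq_Φ (g : Module.Basis (Fin 4) ℂ (complexBetti A.X 1)) (α : complexBetti A.X 2)
    (hα : ofDegree ℂ (ComplexPoints A.X) 2 α = totalCup ℂ _ (e g 0) (e g 1) + totalCup ℂ _ (e g 2) (e g 3)) :
    totalLefschetz α = Eval.Φ (basisB g hA) (mulMat 3 + mulMat 12) := by
  obtain ⟨h3, -, -, -, -, h12⟩ := bvec_two g
  rw [totalLefschetz_eq_totalCup, hα, map_add (totalCup ℂ (ComplexPoints A.X)), map_add (Eval.Φ (basisB g hA)),
    Eval.Φ_apply, Eval.Φ_apply, toLin_mulMat, toLin_mulMat, basisB_apply, basisB_apply, h3, h12]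

end Assembly

end Model

open Model in
/-- (S-C) **Model transport** — registered stub `stub_model` of the v2p5 skeleton of crux stmt-Ventures-20141: for an
abelian surface and `α ∈ H²` with a dual Lefschetz operator `Λ_A`, a homogeneous basis `b` of `H*(A(ℂ); ℂ)` indexed by
bitmasks (`b 0 = 1`, `b I ∈ H^{|I|}`) in which left cup product by `b I` is `mulMat I` and `Λ_A` is `lamMat`. -/
theorem stub_model {A : AbelianVariety ℂ} (hA : A.dim = 2) (α : complexBetti A.X 2)
    (Λ_A : Module.End ℂ (totalCohomology ℂ (ComplexPoints A.X))) (hΛ : IsDualLefschetz 2 α Λ_A) :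
    ∃ b : Module.Basis (Fin 16) ℂ (totalCohomology ℂ (ComplexPoints A.X)),
      b 0 = unitCoeff A.X ∧ (∀ I, b I ∈ LinearMap.range (ofDegree ℂ (ComplexPoints A.X) (deg4 I))) ∧
      (∀ I, Matrix.toLin b b ((mulMat I).map (Int.castRingHom ℂ)) = totalCup ℂ (ComplexPoints A.X) (b I)) ∧
      Matrix.toLin b b (lamMat.map (Int.castRingHom ℂ)) = Λ_A := by
  haveI : Module.Finite ℂ (totalCohomology ℂ (ComplexPoints A.X)) :=
    finite_totalCohomology (n := 2) (X := A.X) (hA ▸ AbelianVariety.isSmoothProjective_holds)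
  letI : LieRing (Module.End ℂ (totalCohomology ℂ (ComplexPoints A.X))) := LieRing.ofAssociativeRing
  obtain ⟨g, hg⟩ := exists_symplectic hA α Λ_A hΛ
  refine ⟨basisB g hA, (basisB_apply hA g 0).trans (bvec_zero g), fun I ↦ (basisB_apply hA g I) ▸ bvec_mem_range g I,
    fun I ↦ toLin_mulMat hA g I, ?_⟩
  -- `Λ' = Φ lamMat` is an `𝔰𝔩₂`-partner of `(L_α, h)`, hence `= Λ_A`
  rw [← Eval.Φ_apply]
  have hh := degreeOperator_eq_Φ hA g
  have hL := totalLefschetz_eq_Φ hA g α hg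
  have hM1 : (mulMat 3 + mulMat 12) * lamMat - lamMat * (mulMat 3 + mulMat 12) =
      Matrix.diagonal (fun I : Fin 16 ↦ (deg4 I : ℤ) - 2) := by decide +kernel
  have hM2 : Matrix.diagonal (fun I : Fin 16 ↦ (deg4 I : ℤ) - 2) * lamMat -
      lamMat * Matrix.diagonal (fun I : Fin 16 ↦ (deg4 I : ℤ) - 2) = -(2 • lamMat) := by decide +kernel
  have ht : IsDualLefschetz 2 α (Eval.Φ (basisB g hA) lamMat) := by
    refine ⟨hΛ.h_ne_zero, ?_, lie_degreeOperator_totalLefschetz 2 α, ?_⟩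
    · rw [Ring.lie_def, hL, hh, ← map_mul, ← map_mul, ← map_sub, hM1]
    · rw [Ring.lie_def, hh, ← map_mul, ← map_mul, ← map_sub, hM2, map_neg, map_nsmul]
  exact (Literature.Algebra.Lie.dualPartner_unique hΛ ht).symm

end Summit.Ventures.HodgeKum4.L1Hilb

end
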